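import Summits.AtomisticToContinuum.FouriersLaw.Theorems.HiddenChargeMazurDressedChargeMainReductionAux2

/-!
# Main reduction for stub S1 of crux `DressedCharge` — helper 4: exactness of the lattice variational
# complex for polynomials

Crux stmt-AtomisticToContinuum-13509 (`HiddenChargeMazur.DressedCharge`), line `birth`, stub G
`stub_mainReduction` (lead). If both discrete Euler operators of a lattice polynomial `f` vanish,
`E_q f = Σ_k τ^{-k} ∂_{q_k} f = 0` and `E_p f = Σ_k τ^{-k} ∂_{p_k} f = 0` (window containing the support),
then `f` is a constant plus a shift-coboundary: `f = C c + H - τH`. Proof: on the homogeneous component of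
degree `n ≥ 1`, Euler's identity `n f_n = Σ_v X_v ∂_v f_n` and `X_{q_k} ∂_{q_k} f_n ≡ X_{q_0} τ^{-k} ∂_{q_k} f_n`
modulo coboundaries give `n f_n ≡ q_0 E_q f_n + p_0 E_p f_n = 0`.
No definitions, no notation.
-/

noncomputable section

namespace Summit.AtomisticToContinuum.FouriersLaw.Theorems.DressedCharge

open MvPolynomial

/-! ## Euler's identity without a finiteness assumption on the variable type -/

/-- Euler's identity for a homogeneous polynomial over an arbitrary variable type, summed over its
variables: `Σ_{v ∈ f.vars} X_v ∂_v f = n • f`. -/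
theorem euler_identity_vars {R σ : Type*} [CommRing R] {f : MvPolynomial σ R} {n : ℕ}
    (hf : f.IsHomogeneous n) : ∑ v ∈ f.vars, X v * pderiv v f = n • f := by
  classical
  obtain ⟨g, hg⟩ := exists_rename_eq_of_vars_subset_range f (Subtype.val : {v // v ∈ f.vars} → σ)
    Subtype.val_injective (by simp)
  have hgh : g.IsHomogeneous n := by
    rw [← IsHomogeneous.rename_isHomogeneous_iff Subtype.val_injective, hg]; exact hf
  have key := hgh.sum_X_mul_pderiv
  apply_fun rename (Subtype.val : {v // v ∈ f.vars} → σ) at key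
  rw [map_sum, map_nsmul, hg] at key
  rw [← key, ← Finset.sum_coe_sort f.vars]
  refine Finset.sum_congr rfl fun v _ => ?_
  rw [map_mul, rename_X, ← pderiv_rename Subtype.val_injective, hg]

/-! ## Coboundaries -/

/-- `τᵏ x - x` is a shift-coboundary `H - τH`. -/
theorem exists_coboundary_shift_sub {R : Type*} [CommRing R] (k : ℤ) (x : MvPolynomial (ℤ ⊕ ℤ) R) :
    ∃ H : MvPolynomial (ℤ ⊕ ℤ) R, rename (Sum.map (fun i : ℤ => i + k) (fun i : ℤ => i + k)) x - x =
      H - rename (Sum.map (fun i : ℤ => i + 1) (fun i : ℤ => i + 1)) H := by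
  induction k using Int.induction_on with
  | zero => exact ⟨0, by rw [shift_zero]; simp⟩
  | succ k ih =>
    obtain ⟨H, hH⟩ := ih
    refine ⟨H - rename (Sum.map (fun i : ℤ => i + (k : ℤ)) (fun i : ℤ => i + (k : ℤ))) x, ?_⟩
    have e : rename (Sum.map (fun i : ℤ => i + ((k : ℤ) + 1)) (fun i : ℤ => i + ((k : ℤ) + 1))) x =
        rename (Sum.map (fun i : ℤ => i + 1) (fun i : ℤ => i + 1))
          (rename (Sum.map (fun i : ℤ => i + (k : ℤ)) (fun i : ℤ => i + (k : ℤ))) x) := by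
      rw [shift_shift]
    rw [e, map_sub]
    have := hH
    linear_combination this
  | pred k ih =>
    obtain ⟨H, hH⟩ := ih
    refine ⟨H + rename (Sum.map (fun i : ℤ => i + (-(k : ℤ) - 1)) (fun i : ℤ => i + (-(k : ℤ) - 1))) x, ?_⟩
    have e : rename (Sum.map (fun i : ℤ => i + -(k : ℤ)) (fun i : ℤ => i + -(k : ℤ))) x =
        rename (Sum.map (fun i : ℤ => i + 1) (fun i : ℤ => i + 1))
          (rename (Sum.map (fun i : ℤ => i + (-(k : ℤ) - 1)) (fun i : ℤ => i + (-(k : ℤ) - 1))) x) := by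
      rw [shift_shift]; exact shift_congr (by ring) _
    rw [e] at hH
    rw [map_add]
    linear_combination hH

/-! ## Variables of homogeneous components -/

/-- The variables of a homogeneous component are variables of the polynomial. -/
theorem vars_homogeneousComponent_subset {R σ : Type*} [CommRing R] [DecidableEq σ] (n : ℕ)
    (f : MvPolynomial σ R) : (homogeneousComponent n f).vars ⊆ f.vars := by
  intro v hv
  rw [mem_vars_iff_mem_support] at hv ⊢
  obtain ⟨d, hd, hvd⟩ := hv
  refine ⟨d, ?_, hvd⟩
  rw [support_homogeneousComponent, Finset.mem_filter] at hd
  exact hd.1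

/-- `pderiv` lowers the degree of a homogeneous polynomial by one. -/
theorem isHomogeneous_pderiv {R σ : Type*} [CommRing R] (v : σ) {f : MvPolynomial σ R} {n : ℕ}
    (hf : f.IsHomogeneous (n + 1)) : (pderiv v f).IsHomogeneous n := by
  classical
  rw [pderiv_def]
  have := isHomogeneous_mkDerivation (R := R) (Pi.single v (1 : MvPolynomial σ R)) 0
    (fun w => by
      by_cases hw : w = v
      · subst hw; simpa using isHomogeneous_one σ R
      · simp [hw, isHomogeneous_zero]) hf
  simpa only [add_zero] using this

/-! ## Exactness -/

/-- A homogeneous polynomial of degree `n ≥ 1` whose two Euler operators vanish is a coboundary. -/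
theorem coboundary_of_euler_zero_homogeneous {K : Type*} [Field K] [CharZero K]
    (f : MvPolynomial (ℤ ⊕ ℤ) K) {n : ℕ} (hn : 1 ≤ n) (hf : f.IsHomogeneous n) (S : Finset ℤ)
    (hSq : ∀ k, Sum.inl k ∈ f.vars → k ∈ S) (hSp : ∀ k, Sum.inr k ∈ f.vars → k ∈ S)
    (hq : ∑ k ∈ S, rename (Sum.map (fun i : ℤ => i + -k) (fun i : ℤ => i + -k)) (pderiv (Sum.inl k) f) = 0)
    (hp : ∑ k ∈ S, rename (Sum.map (fun i : ℤ => i + -k) (fun i : ℤ => i + -k)) (pderiv (Sum.inr k) f) = 0) :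
    ∃ H : MvPolynomial (ℤ ⊕ ℤ) K, f = H - rename (Sum.map (fun i : ℤ => i + 1) (fun i : ℤ => i + 1)) H := by
  classical
  -- Euler over the window
  have heul := euler_identity_vars hf
  have hsplit : ∑ v ∈ f.vars, X v * pderiv v f =
      ∑ k ∈ S, X (Sum.inl k) * pderiv (Sum.inl k) f + ∑ k ∈ S, X (Sum.inr k) * pderiv (Sum.inr k) f := by
    have hdisj : Disjoint (S.image (Sum.inl : ℤ → ℤ ⊕ ℤ)) (S.image (Sum.inr : ℤ → ℤ ⊕ ℤ)) := by
      rw [Finset.disjoint_left]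
      intro v hv hv'
      obtain ⟨a, -, rfl⟩ := Finset.mem_image.mp hv
      obtain ⟨b, -, hb⟩ := Finset.mem_image.mp hv'
      cases hb
    have h1 : ∑ v ∈ f.vars, X v * pderiv v f = ∑ v ∈ S.image Sum.inl ∪ S.image Sum.inr, X v * pderiv v f := by
      apply Finset.sum_subset
      · intro v hv
        rcases v with k | k
        · exact Finset.mem_union_left _ (Finset.mem_image.mpr ⟨k, hSq k hv, rfl⟩)
        · exact Finset.mem_union_right _ (Finset.mem_image.mpr ⟨k, hSp k hv, rfl⟩)
      · intro v _ hv
        rw [pderiv_eq_zero_of_notMem_vars hv, mul_zero]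
    rw [h1, Finset.sum_union hdisj, Finset.sum_image (fun a _ b _ h => Sum.inl.inj h),
      Finset.sum_image (fun a _ b _ h => Sum.inr.inj h)]
  -- each term is a coboundary plus the anchored term
  have hcobq : ∀ k : ℤ, ∃ H : MvPolynomial (ℤ ⊕ ℤ) K, X (Sum.inl k) * pderiv (Sum.inl k) f =
      X (Sum.inl 0) * rename (Sum.map (fun i : ℤ => i + -k) (fun i : ℤ => i + -k)) (pderiv (Sum.inl k) f) +
        (H - rename (Sum.map (fun i : ℤ => i + 1) (fun i : ℤ => i + 1)) H) := by
    intro k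
    obtain ⟨H, hH⟩ := exists_coboundary_shift_sub k
      (X (Sum.inl 0) * rename (Sum.map (fun i : ℤ => i + -k) (fun i : ℤ => i + -k)) (pderiv (Sum.inl k) f))
    refine ⟨H, ?_⟩
    rw [← hH, map_mul, shift_X_inl, zero_add, shift_shift_neg]
    ring
  have hcobp : ∀ k : ℤ, ∃ H : MvPolynomial (ℤ ⊕ ℤ) K, X (Sum.inr k) * pderiv (Sum.inr k) f =
      X (Sum.inr 0) * rename (Sum.map (fun i : ℤ => i + -k) (fun i : ℤ => i + -k)) (pderiv (Sum.inr k) f) +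
        (H - rename (Sum.map (fun i : ℤ => i + 1) (fun i : ℤ => i + 1)) H) := by
    intro k
    obtain ⟨H, hH⟩ := exists_coboundary_shift_sub k
      (X (Sum.inr 0) * rename (Sum.map (fun i : ℤ => i + -k) (fun i : ℤ => i + -k)) (pderiv (Sum.inr k) f))
    refine ⟨H, ?_⟩
    rw [← hH, map_mul, shift_X_inr, zero_add, shift_shift_neg]
    ring
  choose Hq hHq using hcobq
  choose Hp hHp using hcobp
  -- sum up
  have hsum : (n : K) • f = (∑ k ∈ S, Hq k + ∑ k ∈ S, Hp k) -
      rename (Sum.map (fun i : ℤ => i + 1) (fun i : ℤ => i + 1)) (∑ k ∈ S, Hq k + ∑ k ∈ S, Hp k) := by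
    have e1 : ∑ k ∈ S, X (Sum.inl k) * pderiv (Sum.inl k) f =
        X (Sum.inl 0) * ∑ k ∈ S, rename (Sum.map (fun i : ℤ => i + -k) (fun i : ℤ => i + -k)) (pderiv (Sum.inl k) f) +
          (∑ k ∈ S, Hq k - rename (Sum.map (fun i : ℤ => i + 1) (fun i : ℤ => i + 1)) (∑ k ∈ S, Hq k)) := by
      rw [Finset.mul_sum, map_sum, ← Finset.sum_sub_distrib, ← Finset.sum_add_distrib]
      exact Finset.sum_congr rfl fun k _ => hHq k
    have e2 : ∑ k ∈ S, X (Sum.inr k) * pderiv (Sum.inr k) f =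
        X (Sum.inr 0) * ∑ k ∈ S, rename (Sum.map (fun i : ℤ => i + -k) (fun i : ℤ => i + -k)) (pderiv (Sum.inr k) f) +
          (∑ k ∈ S, Hp k - rename (Sum.map (fun i : ℤ => i + 1) (fun i : ℤ => i + 1)) (∑ k ∈ S, Hp k)) := by
      rw [Finset.mul_sum, map_sum, ← Finset.sum_sub_distrib, ← Finset.sum_add_distrib]
      exact Finset.sum_congr rfl fun k _ => hHp k
    rw [Nat.cast_smul_eq_nsmul, ← heul, hsplit, e1, e2, hq, hp, map_add]
    ring
  refine ⟨(n : K)⁻¹ • (∑ k ∈ S, Hq k + ∑ k ∈ S, Hp k), ?_⟩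
  have hn0 : (n : K) ≠ 0 := by exact_mod_cast (show n ≠ 0 by omega)
  apply smul_right_injective _ hn0
  simp only
  rw [hsum, smul_sub, map_smul, smul_smul, mul_inv_cancel₀ hn0, one_smul, smul_smul, mul_inv_cancel₀ hn0, one_smul]

/-- **Exactness of the lattice variational complex (polynomial version).** If both Euler operators of `f`
vanish then `f = C c + H - τH`. -/
theorem exact_of_euler_zero {K : Type*} [Field K] [CharZero K]
    (f : MvPolynomial (ℤ ⊕ ℤ) K) (S : Finset ℤ)
    (hSq : ∀ k, Sum.inl k ∈ f.vars → k ∈ S) (hSp : ∀ k, Sum.inr k ∈ f.vars → k ∈ S)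
    (hq : ∑ k ∈ S, rename (Sum.map (fun i : ℤ => i + -k) (fun i : ℤ => i + -k)) (pderiv (Sum.inl k) f) = 0)
    (hp : ∑ k ∈ S, rename (Sum.map (fun i : ℤ => i + -k) (fun i : ℤ => i + -k)) (pderiv (Sum.inr k) f) = 0) :
    ∃ (c : K) (H : MvPolynomial (ℤ ⊕ ℤ) K),
      f = C c + H - rename (Sum.map (fun i : ℤ => i + 1) (fun i : ℤ => i + 1)) H := by
  classical
  set N := f.totalDegree with hN
  -- Euler operators of the components vanish
  have hcomp : ∀ (ι : ℤ → ℤ ⊕ ℤ), (ι = Sum.inl ∨ ι = Sum.inr) →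
      (∑ k ∈ S, rename (Sum.map (fun i : ℤ => i + -k) (fun i : ℤ => i + -k)) (pderiv (ι k) f) = 0) →
      ∀ m ∈ Finset.range N, ∑ k ∈ S, rename (Sum.map (fun i : ℤ => i + -k) (fun i : ℤ => i + -k))
        (pderiv (ι k) (homogeneousComponent (m + 1) f)) = 0 := by
    intro ι _ hE
    apply eq_zero_of_sum_isHomogeneous_eq_zero (Finset.range N)
      (fun m => ∑ k ∈ S, rename (Sum.map (fun i : ℤ => i + -k) (fun i : ℤ => i + -k))
        (pderiv (ι k) (homogeneousComponent (m + 1) f)))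
    · intro m _
      refine IsHomogeneous.sum _ _ _ fun k _ => isHomogeneous_shift (-k) ?_
      exact isHomogeneous_pderiv (ι k) (homogeneousComponent_isHomogeneous (m + 1) f)
    · -- the sum over m telescopes back to E(f) minus the (vanishing) degree-0 contribution
      have hdec : f = ∑ m ∈ Finset.range (N + 1), homogeneousComponent m f := (sum_homogeneousComponent f).symm
      have h0 : ∀ k, pderiv (ι k) (homogeneousComponent 0 f) = 0 := fun k => by
        rw [homogeneousComponent_zero, pderiv_C]
      have : ∑ k ∈ S, rename (Sum.map (fun i : ℤ => i + -k) (fun i : ℤ => i + -k)) (pderiv (ι k) f) =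
          ∑ m ∈ Finset.range N, ∑ k ∈ S, rename (Sum.map (fun i : ℤ => i + -k) (fun i : ℤ => i + -k))
            (pderiv (ι k) (homogeneousComponent (m + 1) f)) := by
        conv_lhs => rw [hdec]
        rw [Finset.sum_comm]
        refine Finset.sum_congr rfl fun k _ => ?_
        rw [map_sum, map_sum, Finset.sum_range_succ', h0, map_zero, add_zero]
      rw [← this, hE]
  have hq' := hcomp Sum.inl (Or.inl rfl) hq
  have hp' := hcomp Sum.inr (Or.inr rfl) hp
  -- each positive-degree component is a coboundary
  have hvarsS : ∀ m (ι : ℤ → ℤ ⊕ ℤ), (∀ k, ι k ∈ f.vars → k ∈ S) →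
      ∀ k, ι k ∈ (homogeneousComponent m f).vars → k ∈ S :=
    fun m ι hι k hk => hι k (vars_homogeneousComponent_subset m f hk)
  have hcob : ∀ m ∈ Finset.range N, ∃ H : MvPolynomial (ℤ ⊕ ℤ) K, homogeneousComponent (m + 1) f =
      H - rename (Sum.map (fun i : ℤ => i + 1) (fun i : ℤ => i + 1)) H :=
    fun m hm => coboundary_of_euler_zero_homogeneous _ (by omega) (homogeneousComponent_isHomogeneous (m + 1) f) S
      (hvarsS (m + 1) Sum.inl hSq) (hvarsS (m + 1) Sum.inr hSp) (hq' m hm) (hp' m hm)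
  choose! Hm hHm using hcob
  refine ⟨coeff 0 f, ∑ m ∈ Finset.range N, Hm m, ?_⟩
  conv_lhs => rw [(sum_homogeneousComponent f).symm, Finset.sum_range_succ']
  rw [homogeneousComponent_zero, map_sum, ← hN, Finset.sum_congr rfl hHm, Finset.sum_sub_distrib]
  ring

/-- ANCHOR of this helper file (registered sub-goal of the crux): exactness of the lattice variational
complex for real lattice polynomials. -/
theorem mainReduction_exactness_anchor_real :
    ∀ (f : MvPolynomial (ℤ ⊕ ℤ) ℝ) (S : Finset ℤ), (∀ k, Sum.inl k ∈ f.vars → k ∈ S) → (∀ k, Sum.inr k ∈ f.vars → k ∈ S) → (∑ k ∈ S, MvPolynomial.rename (Sum.map (fun i : ℤ => i + -k) (fun i : ℤ => i + -k)) (MvPolynomial.pderiv (Sum.inl k) f) = 0) → (∑ k ∈ S, MvPolynomial.rename (Sum.map (fun i : ℤ => i + -k) (fun i : ℤ => i + -k)) (MvPolynomial.pderiv (Sum.inr k) f) = 0) → ∃ (c : ℝ) (H : MvPolynomial (ℤ ⊕ ℤ) ℝ), f = MvPolynomial.C c + H - MvPolynomial.rename (Sum.map (fun i : ℤ => i + 1)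 (fun i : ℤ => i + 1)) H :=
  fun f S hSq hSp hq hp => exact_of_euler_zero f S hSq hSp hq hp

end Summit.AtomisticToContinuum.FouriersLaw.Theorems.DressedCharge

end
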